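import Literature.NumberTheory.GaloisRepresentations.ContinuousCohomologySESEulerIdentity
import Literature.NumberTheory.GaloisRepresentations.PPrimaryDevissage
import Literature.NumberTheory.GaloisRepresentations.CorNaturality
import HarnessLib

/-!
# Split extensions of discrete modules; reduction of `#H⁰ · #H² · #M^e = #H¹` to `p`-primary `M`

Topic `NumberTheory/GaloisRepresentations`; namespace
`Literature.NumberTheory.GaloisRepresentations`.  THEOREMS ONLY (no definition, no named fact,
no `sorry`, no instance; D-0026).

Euler–Poincaré characteristic formulas `#H⁰(G, M) · #H²(G, M) · #M^e = #H¹(G, M)` (Tate's local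
formula, Milne ADT I Thm. 2.8; Tate's global formula at a totally complex number field, Milne ADT I
Thm. 5.1 / NSW (8.7.4), `e = r₂`) are multiplicative in `M`, and every proof first reduces to
`p`-primary `M`.  This file proves that reduction for the continuous-cochain cohomology of the
tree's discrete `ContinuousRep`s, unconditionally and with no finiteness of cohomology, along the
`G`-stable PRIMARY DECOMPOSITION `M = M[p^a] ⊕ M[#M/p^a]` (split, so no connecting map intervenes):
* §1 (`M = W ⊕ C`, `W`, `C` `G`-stable): **`natCard_invariants_eq_mul_of_isCompl`**,
  **`natCard_continuousCohomology_eq_mul_of_isCompl`** — `#Hⁿ(G, M) = #Hⁿ(G, W) · #Hⁿ(G, M/W)`,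
  `n ≤ 2`: `0 → W → M → M/W → 0` (`isSES_subtype_mkQ`) is split by the projection along `C`, so
  `Hⁿ(W) ↪ Hⁿ(M) ↠ Hⁿ(M/W)` and exactness at `Hⁿ(M)` (`ContinuousCohomologyConnecting`) counts.
* §2 **`euler_of_forall_prime_primary`** — `G` locally compact, `M` finite discrete: the identity
  for every finite discrete `p`-primary `B` (`IsPrimaryTorsion p B`), every prime `p ∣ #M`, implies
  it for `M` (strong induction on `#M`; Cauchy, Bézout).
Consumer: `GaloisCohomology/TateGlobalEulerCharacteristicOfPrimaryTC.lean` (cell `bsd-eis`, crux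
`GoodLatticeBDPValue`, stmt-BirchSwinnertonDyer-19032, lane «TATE-EPC-TC» brick B0).  Compare
`CoprimeTorsionSplitting.lean` (CRT-idempotent form, local side) and `PPrimaryDevissage.lean`.

## References
* J. S. Milne, *Arithmetic Duality Theorems*, 2nd ed. (2006), Ch. I §2, proof of Thm. 2.8, and
  Ch. I §5, proof of Thm. 5.1 (pp. 67–70). [MilneADT2006]
* J. Neukirch, A. Schmidt, K. Wingberg, *Cohomology of Number Fields*, 2nd ed. (2008), (8.7.4)
  (proof). [NeukirchSchmidtWingberg2008]
* J.-P. Serre, *Galois Cohomology* (1997), I §2.2, I §3.1. [SerreGaloisCohomology1997]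
-/
noncomputable section

open CategoryTheory Function

universe u

namespace Literature.NumberTheory.GaloisRepresentations

open _root_.TopRep _root_.ContRepresentation _root_.ContinuousCohomology

section Algebra -- §0: counting, equivariant projections, primary parts

/-- `#B = #A · #C` for `A ↪ B ↠ C` exact at `B` (no finiteness needed: `Nat.card` of an infinite
type is `0` on both sides consistently). [folklore] -/
private theorem natCard_eq_mul_of_exact {α β γ : Type*} [AddCommGroup α] [AddCommGroup β]
    [AddCommGroup γ] (φ : α →+ β) (ψ : β →+ γ) (hφ : Injective φ) (hψ : Surjective ψ)
    (h₁ : ∀ a, ψ (φ a) = 0) (h₂ : ∀ b, ψ b = 0 → ∃ a, φ a = b) :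
    Nat.card β = Nat.card α * Nat.card γ := by
  have hker : ψ.ker = φ.range := by
    ext b
    rw [AddMonoidHom.mem_ker, AddMonoidHom.mem_range]
    exact ⟨h₂ b, by rintro ⟨a, rfl⟩; exact h₁ a⟩
  rw [AddSubgroup.card_eq_card_quotient_mul_card_addSubgroup ψ.ker,
    Nat.card_congr (QuotientAddGroup.quotientKerEquivOfSurjective ψ hψ).toEquiv, hker,
    ← Nat.card_congr (AddMonoidHom.ofInjective hφ).toEquiv, mul_comm]

variable {M : Type u} [AddCommGroup M] {W C : Submodule ℤ M}

/-- The projection onto `W` along `C` commutes with every additive map preserving `W` and `C`.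
[folklore] -/
private theorem coe_projectionOnto_map (hWC : IsCompl W C) (f : M →ₗ[ℤ] M)
    (hW : W ≤ W.comap f) (hC : C ≤ C.comap f) (m : M) :
    ((W.projectionOnto C hWC (f m) : W) : M) = f (W.projectionOnto C hWC m : M) := by
  have hc : m - (W.projectionOnto C hWC m : M) ∈ C :=
    (Submodule.projectionOnto_apply_eq_zero_iff hWC).1
      (by rw [map_sub, Submodule.projectionOnto_apply_left, sub_self])
  have h1 : f m = f (W.projectionOnto C hWC m : M) + f (m - (W.projectionOnto C hWC m : M)) := by
    rw [← map_add, add_sub_cancel]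
  rw [h1, map_add, Submodule.coe_add,
    Submodule.projectionOnto_apply_of_mem_left hWC (hW (W.projectionOnto C hWC m).2),
    Submodule.projectionOnto_apply_of_mem_right hWC (hC hc), Submodule.coe_zero, add_zero]

/-- A torsion submodule `M[r]` is stable under every additive endomorphism. [folklore] -/
private theorem torsionBy_le_comap (f : M →ₗ[ℤ] M) (r : ℤ) :
    Submodule.torsionBy ℤ M r ≤ (Submodule.torsionBy ℤ M r).comap f := fun x hx => by
  rw [Submodule.mem_comap, Submodule.mem_torsionBy_iff] at *
  rw [← f.map_smul, hx, map_zero]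

/-- **Primary splitting** `M = M[q] ⊕ M[m]` for a finite abelian group of order `q · m` with
`q`, `m` coprime (Bézout). [folklore] -/
private theorem isCompl_torsionBy_of_coprime [Finite M] {q m : ℕ} (hqm : q.Coprime m)
    (hcard : q * m = Nat.card M) :
    IsCompl (Submodule.torsionBy ℤ M (q : ℤ)) (Submodule.torsionBy ℤ M (m : ℤ)) := by
  obtain ⟨u, v, huv⟩ := Nat.isCoprime_iff_coprime.2 hqm
  have hkill : ∀ x : M, ((q : ℤ) * (m : ℤ)) • x = 0 := fun x => by
    rw [← Nat.cast_mul, hcard, natCast_zsmul]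
    obtain ⟨c, hc⟩ := addOrderOf_dvd_natCard x
    rw [hc, mul_nsmul, addOrderOf_nsmul_eq_zero, nsmul_zero]
  refine isCompl_iff.2 ⟨(Submodule.disjoint_def).2 fun x hq hm => ?_,
    codisjoint_iff.2 (Submodule.eq_top_iff'.2 fun x => Submodule.mem_sup.2 ?_)⟩
  · rw [Submodule.mem_torsionBy_iff] at hq hm
    rw [← one_smul ℤ x, ← huv, add_smul, mul_smul, mul_smul, hq, hm, smul_zero, smul_zero,
      add_zero]
  · refine ⟨(v * (m : ℤ)) • x, ?_, (u * (q : ℤ)) • x, ?_, ?_⟩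
    · rw [Submodule.mem_torsionBy_iff, ← mul_smul, ← mul_assoc, mul_comm (q : ℤ) v, mul_assoc,
        mul_smul, hkill, smul_zero]
    · rw [Submodule.mem_torsionBy_iff, ← mul_smul, ← mul_assoc, mul_comm (m : ℤ) u, mul_assoc,
        mul_comm (m : ℤ) (q : ℤ), mul_smul, hkill, smul_zero]
    · rw [← add_smul, add_comm, huv, one_smul]

end Algebra

section Split -- §1: cohomology of a split extension of discrete modules

variable {G : Type u} [Group G] [TopologicalSpace G] [IsTopologicalGroup G]
variable {M : Type u} [AddCommGroup M] [TopologicalSpace M] [DiscreteTopology M]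
variable (ρ : ContinuousRep G ℤ M) {W C : Submodule ℤ M}

omit [IsTopologicalGroup G] in
/-- The extension `0 → W → M → M/W → 0` admits a **retraction** `M → W` (the projection along the
`G`-stable complement `C`), as a morphism of discrete `G`-modules. [folklore] -/
private theorem exists_retraction_subtypeHom (hW : ∀ g, W ≤ W.comap (ρ g))
    (hC : ∀ g, C ≤ C.comap (ρ g)) (hWC : IsCompl W C) :
    ∃ r : ρ.toTopRep ⟶ (ρ.subrepresentation W hW).toTopRep, subtypeHom ρ W hW ≫ r = 𝟙 _ :=
  ⟨TopRep.ofHom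
    { toLinearMap := W.projectionOnto C hWC
      cont := continuous_of_discreteTopology
      isIntertwining' := fun g => ContinuousLinearMap.ext fun m =>
        Subtype.ext (coe_projectionOnto_map hWC (ρ g) (hW g) (hC g) m) },
    TopRep.hom_ext (ContIntertwiningMap.ext (ContinuousLinearMap.ext fun w =>
      Submodule.projectionOnto_apply_left hWC w))⟩

/-- The extension `0 → W → M → M/W → 0` admits a **section** `M/W → M` (`m mod W ↦` the
`C`-component of `m`), as a morphism of discrete `G`-modules. [folklore] -/
private theorem exists_section_mkQHom (hW : ∀ g, W ≤ W.comap (ρ g))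
    (hC : ∀ g, C ≤ C.comap (ρ g)) (hWC : IsCompl W C) :
    ∃ s : (ρ.quotient W hW).toTopRep ⟶ ρ.toTopRep, s ≫ ρ.mkQHom W hW = 𝟙 _ := by
  have hq : ∀ m : M, Submodule.Quotient.mk (p := W) (C.projection W hWC.symm m) =
      Submodule.Quotient.mk m := fun m => by
    refine (Submodule.Quotient.eq W).2 ?_
    have hc : m - (C.projectionOnto W hWC.symm m : M) ∈ W :=
      (Submodule.projectionOnto_apply_eq_zero_iff hWC.symm).1
        (by rw [map_sub, Submodule.projectionOnto_apply_left, sub_self])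
    have := W.neg_mem hc
    rwa [neg_sub] at this
  refine ⟨TopRep.ofHom
    { toLinearMap := W.liftQ (C.projection W hWC.symm) (Submodule.ker_projection hWC.symm).ge
      cont := continuous_of_discreteTopology
      isIntertwining' := fun g => ?_ }, ?_⟩
  · refine ContinuousLinearMap.ext fun x => ?_
    induction x using Submodule.Quotient.induction_on with
    | _ m =>
      change W.liftQ (C.projection W hWC.symm) (Submodule.ker_projection hWC.symm).ge
          (ρ.quotient W hW g (Submodule.Quotient.mk m)) =
        ρ g (W.liftQ (C.projection W hWC.symm) (Submodule.ker_projection hWC.symm).ge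
          (Submodule.Quotient.mk m))
      rw [ContinuousRep.quotient_apply_mk, Submodule.liftQ_apply, Submodule.liftQ_apply,
        Submodule.projection_apply, Submodule.projection_apply]
      exact coe_projectionOnto_map hWC.symm (ρ g) (hC g) (hW g) m
  · refine TopRep.hom_ext (ContIntertwiningMap.ext (ContinuousLinearMap.ext fun x => ?_))
    induction x using Submodule.Quotient.induction_on with
    | _ m =>
      change Submodule.Quotient.mk (p := W)
          (W.liftQ (C.projection W hWC.symm) (Submodule.ker_projection hWC.symm).ge
            (Submodule.Quotient.mk m)) = Submodule.Quotient.mk m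
      rw [Submodule.liftQ_apply]
      exact hq m

/-- `Hⁿ(W) → Hⁿ(M)` is injective (it has a retraction). [folklore] -/
private theorem cohomologyMap_subtypeHom_injective
    (hW : ∀ g, W ≤ W.comap (ρ g)) (hC : ∀ g, C ≤ C.comap (ρ g)) (hWC : IsCompl W C) (n : ℕ) :
    Injective (cohomologyMap (subtypeHom ρ W hW) n) := by
  obtain ⟨r, hr⟩ := exists_retraction_subtypeHom ρ hW hC hWC
  refine LeftInverse.injective (g := cohomologyMap r n) fun x => ?_
  rw [← cohomologyMap_comp_apply, hr,
    show cohomologyMap (𝟙 (ρ.subrepresentation W hW).toTopRep) n = 𝟙 _ from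
      map_id_eq_id _ (fun _ => rfl) n]
  rfl

/-- `Hⁿ(M) → Hⁿ(M/W)` is surjective (it has a section). [folklore] -/
private theorem cohomologyMap_mkQHom_surjective
    (hW : ∀ g, W ≤ W.comap (ρ g)) (hC : ∀ g, C ≤ C.comap (ρ g)) (hWC : IsCompl W C) (n : ℕ) :
    Surjective (cohomologyMap (ρ.mkQHom W hW) n) := by
  obtain ⟨s, hs⟩ := exists_section_mkQHom ρ hW hC hWC
  refine RightInverse.surjective (g := cohomologyMap s n) fun x => ?_
  have h := (cohomologyMap_comp_apply s (ρ.mkQHom W hW) n x).symm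
  have h1 : cohomologyMap (s ≫ ρ.mkQHom W hW) n x = x := by
    rw [hs, show cohomologyMap (𝟙 (ρ.quotient W hW).toTopRep) n = 𝟙 _ from
      map_id_eq_id _ (fun _ => rfl) n]
    rfl
  exact h.trans h1

/-- The counting step: `#Hⁿ(M) = #Hⁿ(W) · #Hⁿ(M/W)` once `Hⁿ(W) → Hⁿ(M) → Hⁿ(M/W)` is exact with
zero composite (degrees `n = 1, 2` below). [folklore] -/
private theorem natCard_continuousCohomology_eq_mul_aux
    (hW : ∀ g, W ≤ W.comap (ρ g)) (hC : ∀ g, C ≤ C.comap (ρ g)) (hWC : IsCompl W C) (n : ℕ)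
    (h₁ : ∀ x, cohomologyMap (ρ.mkQHom W hW) n (cohomologyMap (subtypeHom ρ W hW) n x) = 0)
    (h₂ : ∀ y, cohomologyMap (ρ.mkQHom W hW) n y = 0 →
      ∃ x, cohomologyMap (subtypeHom ρ W hW) n x = y) :
    Nat.card (continuousCohomology n ρ.toTopRep) =
      Nat.card (continuousCohomology n (ρ.subrepresentation W hW).toTopRep) *
        Nat.card (continuousCohomology n (ρ.quotient W hW).toTopRep) :=
  natCard_eq_mul_of_exact (cohomologyMap (subtypeHom ρ W hW) n).hom.toLinearMap.toAddMonoidHom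
    (cohomologyMap (ρ.mkQHom W hW) n).hom.toLinearMap.toAddMonoidHom
    (cohomologyMap_subtypeHom_injective ρ hW hC hWC n)
    (cohomologyMap_mkQHom_surjective ρ hW hC hWC n) h₁ h₂

/-- **`#H⁰(G, M) = #H⁰(G, W) · #H⁰(G, M/W)`** for a `G`-stable decomposition `M = W ⊕ C` of a
discrete `G`-module (invariants currency; `W`, `C` `G`-stable, `IsCompl W C`).
[cite: SerreGaloisCohomology1997, I §2.2] -/
theorem natCard_invariants_eq_mul_of_isCompl (hW : ∀ g, W ≤ W.comap (ρ g))
    (hC : ∀ g, C ≤ C.comap (ρ g)) (hWC : IsCompl W C) :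
    Nat.card ρ.toTopRep.ρ.invariants =
      Nat.card (ρ.subrepresentation W hW).toTopRep.ρ.invariants *
        Nat.card (ρ.quotient W hW).toTopRep.ρ.invariants := by
  have h := isSES_subtype_mkQ ρ W hW
  let ι₀ : (ρ.subrepresentation W hW).toTopRep.ρ.invariants →+ ρ.toTopRep.ρ.invariants :=
    AddMonoidHom.mk' (fun w => ⟨(subtypeHom ρ W hW).hom (w : W), fun σ => by
        change ρ σ ((subtypeHom ρ W hW).hom (w : W)) = (subtypeHom ρ W hW).hom (w : W)
        rw [← ContinuousRep.hom_comm_apply (subtypeHom ρ W hW) σ]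
        exact congrArg (subtypeHom ρ W hW).hom (w.2 σ)⟩)
      fun a b => Subtype.ext (show (subtypeHom ρ W hW).hom
          ((a + b : (ρ.subrepresentation W hW).toTopRep.ρ.invariants) : W) =
          (subtypeHom ρ W hW).hom (a : W) + (subtypeHom ρ W hW).hom (b : W) by
        rw [Submodule.coe_add, map_add])
  let π₀ : ρ.toTopRep.ρ.invariants →+ (ρ.quotient W hW).toTopRep.ρ.invariants :=
    AddMonoidHom.mk' (fun w => ⟨(ρ.mkQHom W hW).hom (w : M), fun σ => by
        change ρ.quotient W hW σ ((ρ.mkQHom W hW).hom (w : M)) = (ρ.mkQHom W hW).hom (w : M)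
        rw [← ContinuousRep.hom_comm_apply (ρ.mkQHom W hW) σ]
        exact congrArg (ρ.mkQHom W hW).hom (w.2 σ)⟩)
      fun a b => Subtype.ext (show (ρ.mkQHom W hW).hom ((a + b : ρ.toTopRep.ρ.invariants) : M) =
          (ρ.mkQHom W hW).hom (a : M) + (ρ.mkQHom W hW).hom (b : M) by
        rw [Submodule.coe_add, map_add])
  have hι₀ : Injective ι₀ := fun a b hab =>
    Subtype.ext (h.injective (congrArg (fun w : ρ.toTopRep.ρ.invariants => (w : M)) hab))
  obtain ⟨s, hs⟩ := exists_section_mkQHom ρ hW hC hWC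
  have hs' : ∀ q : M ⧸ W, (ρ.mkQHom W hW).hom (s.hom q) = q := fun q => by
    change (s ≫ ρ.mkQHom W hW).hom q = q
    rw [hs]
    rfl
  have hπ₀ : Surjective π₀ := fun v => by
    refine ⟨⟨s.hom (v : M ⧸ W), fun σ => ?_⟩, Subtype.ext (hs' (v : M ⧸ W))⟩
    change ρ σ (s.hom (v : M ⧸ W)) = s.hom (v : M ⧸ W)
    rw [← ContinuousRep.hom_comm_apply s σ]
    exact congrArg s.hom (v.2 σ)
  refine natCard_eq_mul_of_exact ι₀ π₀ hι₀ hπ₀ (fun a => Subtype.ext (h.g_f_apply (a : W)))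
    fun w hw => ?_
  have hw' : (ρ.mkQHom W hW).hom (w : M) = 0 :=
    congrArg (fun v : (ρ.quotient W hW).toTopRep.ρ.invariants => (v : M ⧸ W)) hw
  obtain ⟨x, hx⟩ := h.exact_mid (w : M) hw'
  refine ⟨⟨x, fun σ => h.injective ?_⟩, Subtype.ext hx⟩
  change (subtypeHom ρ W hW).hom (ρ.subrepresentation W hW σ x) = (subtypeHom ρ W hW).hom x
  rw [ContinuousRep.hom_comm_apply (subtypeHom ρ W hW) σ, hx]
  exact w.2 σ

/-- **`#Hⁿ(G, M) = #Hⁿ(G, W) · #Hⁿ(G, M/W)` for `n ≤ 2`** and a `G`-stable decomposition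
`M = W ⊕ C` of a discrete `G`-module: `0 → W → M → M/W → 0` splits, so the long exact sequence
breaks into split short ones. [cite: SerreGaloisCohomology1997, I §2.2]
[cite: MilneADT2006, Ch. I §2, proof of Thm. 2.8] -/
theorem natCard_continuousCohomology_eq_mul_of_isCompl [LocallyCompactSpace G]
    (hW : ∀ g, W ≤ W.comap (ρ g)) (hC : ∀ g, C ≤ C.comap (ρ g)) (hWC : IsCompl W C)
    {n : ℕ} (hn : n ≤ 2) :
    Nat.card (continuousCohomology n ρ.toTopRep) =
      Nat.card (continuousCohomology n (ρ.subrepresentation W hW).toTopRep) *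
        Nat.card (continuousCohomology n (ρ.quotient W hW).toTopRep) := by
  have h := isSES_subtype_mkQ ρ W hW
  interval_cases n
  · rw [natCard_continuousCohomology_zero_eq_invariants,
      natCard_continuousCohomology_zero_eq_invariants,
      natCard_continuousCohomology_zero_eq_invariants]
    exact natCard_invariants_eq_mul_of_isCompl ρ hW hC hWC
  · exact natCard_continuousCohomology_eq_mul_aux ρ hW hC hWC 1 (fun x => h.map_one_map_one x)
      fun y hy => h.exists_map_one_eq_of_map_one_eq_zero y hy
  · exact natCard_continuousCohomology_eq_mul_aux ρ hW hC hWC 2 (fun x => h.map_two_map_two x)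
      fun y hy => h.exists_map_two_eq_of_map_two_eq_zero y hy

end Split

section Primary -- §2: reduction of an Euler identity to `p`-primary modules

variable {G : Type u} [Group G] [TopologicalSpace G] [IsTopologicalGroup G] [LocallyCompactSpace G]

/-- **Reduction of `#H⁰ · #H² · #M^e = #H¹` to `p`-primary coefficient modules** (Milne ADT I
§5, proof of Thm. 5.1; NSW (8.7.4), proof: `χ` is multiplicative, so one reduces to `p`-primary
`M`): for a locally compact `G`, an exponent `e` and a finite discrete `G`-module `M`, if the
identity holds for every finite discrete `p`-PRIMARY `G`-module `B`, for every prime `p ∣ #M`, then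
it holds for `M` — strong induction on `#M`, splitting `M = M[p^a] ⊕ M[#M/p^a]` (`p^a ∥ #M`)
`G`-stably (Bézout) and using `natCard_continuousCohomology_eq_mul_of_isCompl`.
[cite: MilneADT2006, Ch. I §5, proof of Thm. 5.1 (pp. 67–70)]
[cite: NeukirchSchmidtWingberg2008, (8.7.4) (proof)] -/
theorem euler_of_forall_prime_primary (e : ℕ) {M : Type u} [AddCommGroup M] [TopologicalSpace M]
    [DiscreteTopology M] [Finite M] (ρ : ContinuousRep G ℤ M)
    (hP : ∀ p : ℕ, p.Prime → p ∣ Nat.card M →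
      ∀ (B : Type u) [AddCommGroup B] [TopologicalSpace B] [DiscreteTopology B] [Finite B]
        (τ : ContinuousRep G ℤ B), IsPrimaryTorsion p B →
        Nat.card (continuousCohomology 0 τ.toTopRep) *
          Nat.card (continuousCohomology 2 τ.toTopRep) * Nat.card B ^ e =
          Nat.card (continuousCohomology 1 τ.toTopRep)) :
    Nat.card (continuousCohomology 0 ρ.toTopRep) * Nat.card (continuousCohomology 2 ρ.toTopRep) *
        Nat.card M ^ e = Nat.card (continuousCohomology 1 ρ.toTopRep) := by
  classical
  suffices key : ∀ (k : ℕ) (M : Type u) [AddCommGroup M] [TopologicalSpace M] [DiscreteTopology M]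
      [Finite M] (ρ : ContinuousRep G ℤ M), Nat.card M = k →
      (∀ p : ℕ, p.Prime → p ∣ Nat.card M →
        ∀ (B : Type u) [AddCommGroup B] [TopologicalSpace B] [DiscreteTopology B] [Finite B]
          (τ : ContinuousRep G ℤ B), IsPrimaryTorsion p B →
          Nat.card (continuousCohomology 0 τ.toTopRep) *
              Nat.card (continuousCohomology 2 τ.toTopRep) * Nat.card B ^ e =
            Nat.card (continuousCohomology 1 τ.toTopRep)) →
      Nat.card (continuousCohomology 0 ρ.toTopRep) * Nat.card (continuousCohomology 2 ρ.toTopRep) *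
          Nat.card M ^ e = Nat.card (continuousCohomology 1 ρ.toTopRep) from key _ M ρ rfl hP
  intro k
  induction k using Nat.strong_induction_on with
  | _ k ih =>
    intro M _ _ _ _ ρ hk hM
    by_cases htriv : Subsingleton M
    · have h0 : Nat.card (continuousCohomology 0 ρ.toTopRep) = 1 := by
        rw [natCard_continuousCohomology_zero_eq_invariants]
        exact Nat.card_of_subsingleton 0
      have h1 : Nat.card (continuousCohomology 1 ρ.toTopRep) = 1 := by
        haveI := subsingleton_continuousCohomology_of_subsingleton ρ.toTopRep 0
        exact Nat.card_of_subsingleton 0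
      have h2 : Nat.card (continuousCohomology 2 ρ.toTopRep) = 1 := by
        haveI := subsingleton_continuousCohomology_of_subsingleton ρ.toTopRep 1
        exact Nat.card_of_subsingleton 0
      rw [h0, h1, h2, Nat.card_of_subsingleton (0 : M), one_pow, mul_one, mul_one]
    haveI : Nontrivial M := not_subsingleton_iff_nontrivial.1 htriv
    have hM0 : Nat.card M ≠ 0 := (Nat.card_pos (α := M)).ne'
    obtain ⟨p, hp, hpM⟩ := Nat.exists_prime_and_dvd (Finite.one_lt_card (α := M)).ne'
    haveI : Fact p.Prime := ⟨hp⟩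
    obtain ⟨a, ha_def⟩ : ∃ a : ℕ, a = (Nat.card M).factorization p := ⟨_, rfl⟩
    obtain ⟨m, hm_def⟩ : ∃ m : ℕ, m = Nat.card M / p ^ a := ⟨_, rfl⟩
    have ha : 0 < a := ha_def ▸ hp.factorization_pos_of_dvd hM0 hpM
    have hqm : (p ^ a).Coprime m := by
      rw [hm_def, ha_def]
      exact (Nat.coprime_ordCompl hp hM0).pow_left _
    have hcardM : p ^ a * m = Nat.card M := by
      rw [hm_def, ha_def]
      exact Nat.ordProj_mul_ordCompl_eq_self (Nat.card M) p
    obtain ⟨W, hWdef⟩ : ∃ W : Submodule ℤ M, W = Submodule.torsionBy ℤ M ((p ^ a : ℕ) : ℤ) :=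
      ⟨_, rfl⟩
    obtain ⟨C, hCdef⟩ : ∃ C : Submodule ℤ M, C = Submodule.torsionBy ℤ M (m : ℤ) := ⟨_, rfl⟩
    have hW : ∀ g, W ≤ W.comap (ρ g) := fun g => by
      rw [hWdef]
      exact torsionBy_le_comap (ρ g) _
    have hC : ∀ g, C ≤ C.comap (ρ g) := fun g => by
      rw [hCdef]
      exact torsionBy_le_comap (ρ g) _
    have hWC : IsCompl W C := by
      rw [hWdef, hCdef]
      exact isCompl_torsionBy_of_coprime hqm hcardM
    obtain ⟨x, hx⟩ := exists_prime_addOrderOf_dvd_card' (G := M) p hpM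
    have hx0 : x ≠ 0 := by
      intro h0
      rw [h0, addOrderOf_zero] at hx
      exact hp.one_lt.ne' hx.symm
    have hxW : x ∈ W := by
      refine hWdef.ge ((Submodule.mem_torsionBy_iff _ _).2 ?_)
      rw [natCast_zsmul]
      obtain ⟨c, hc⟩ := dvd_pow_self p ha.ne'
      rw [hc, mul_nsmul, ← hx, addOrderOf_nsmul_eq_zero, nsmul_zero]
    have hWprim : IsPrimaryTorsion p W := fun w => ⟨a, Subtype.ext (by
      rw [Submodule.coe_smul_of_tower, ZeroMemClass.coe_zero, ← natCast_zsmul]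
      exact (Submodule.mem_torsionBy_iff _ _).1 (hWdef.le w.2))⟩
    have hcardW : 1 < Nat.card W :=
      Finite.one_lt_card_iff_nontrivial.2 ⟨⟨⟨x, hxW⟩, 0, fun h0 => hx0 (congrArg Subtype.val h0)⟩⟩
    haveI : Finite (M ⧸ W) := Finite.of_surjective _ (Submodule.Quotient.mk_surjective W)
    have hmul := Submodule.card_eq_card_quotient_mul_card W
    have hlt : Nat.card (M ⧸ W) < k := by
      rw [← hk, hmul]
      exact lt_mul_left Nat.card_pos hcardW
    have hdvdQ : Nat.card (M ⧸ W) ∣ Nat.card M := ⟨Nat.card W, by rw [hmul, mul_comm]⟩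
    have eW := hM p hp hpM W (ρ.subrepresentation W hW) hWprim
    have eQ : Nat.card (continuousCohomology 0 (ρ.quotient W hW).toTopRep) *
          Nat.card (continuousCohomology 2 (ρ.quotient W hW).toTopRep) * Nat.card (M ⧸ W) ^ e =
        Nat.card (continuousCohomology 1 (ρ.quotient W hW).toTopRep) :=
      ih _ hlt (M ⧸ W) (ρ.quotient W hW) rfl (fun ℓ hℓ hℓQ => hM ℓ hℓ (hℓQ.trans hdvdQ))
    rw [natCard_continuousCohomology_eq_mul_of_isCompl ρ hW hC hWC (n := 0) (by omega),
      natCard_continuousCohomology_eq_mul_of_isCompl ρ hW hC hWC (n := 1) (by omega),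
      natCard_continuousCohomology_eq_mul_of_isCompl ρ hW hC hWC (n := 2) (by omega),
      hmul, mul_pow, ← eW, ← eQ]
    ring

end Primary

end Literature.NumberTheory.GaloisRepresentations

end
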